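/-
Copyright (c) 2026 the pub-hodgecm-mathlib formalisation cell (harness21).  Prover seat hodgecm-mathlib-K2E3-p17 (g2),
Track B «K2-LIT» ∕ h413, line `K2_E3_EllipticInputs`, unit U5 — ROAD K-EP toward #20′ `sig_K2E3PseudoCoeffPosOnePi2`, THIRD BRICK sub-brick (3a):
THE AVERAGING LEMMA «a translation-stable space of functions on a finite homogeneous space whose `B`-fixed elements are constant is constant».  2026-09-03∕04.
-/
import Mathlib
import HarnessLib

/-!
# K2_E3 road K-EP (#20′, POS-ONE at `π²(ξ)`), third brick (3a): the averaging lemma on a finite homogeneous space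

Cell `pub/hodgecm-mathlib` (D-0151), Track B; dealer K2E3-plan (g1) 23:40:43Z (e) «#20′ ↦ K2E3-p17»; K2E3-p17 (g2) REPORT-FIRST 23:50:39Z (third brick cut
(3a)–(3e)).  THEOREMS ONLY; Mathlib-only; GENERIC (any group `G`, any finite `G`-set `X`, any field of characteristic zero).

WHY.  The depth-zero K-type dimensions of `π²(ξ₀)` (`d = (q³, 1, 1)`, K2E3-p20 (g2) 23:36:34Z ∕ ★ brick 2 `K2E3EPFunctionValueAtOneDepthZero`) follow from the Mackey
COUNTS of the principal series `V = i_G(χ₁) ⊇ {π², πⁿ}` (`dim V^{K₀⁺} = [K₀:I] = q³+1`, `dim V^{K₂⁺} = q+1`, `dim V^{I⁺} = 2`), exactness of `U`-fixed vectors, the sphericity of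
the two constituents, and ONE structural fact about the permutation module `V^{K⁺}|_K ≅ Fun(I∖K)`: a `K`-stable subspace whose `I`-fixed line is the constants IS the
constants — so `(πⁿ)^{K₀⁺} = ` its spherical line (`dim 1`, hence `d₀(π²) = q³`) and `(π²)^{K₂⁺} =` its spherical line (`d₂(π²) = 1`).  No irreducibility of the
Steinberg representation of `U₃(𝔽_q)` and no character theory is used [cf. Borel1976 §3–§4; Casselman1995 §3 on `V^{K⁺}` as a module for the finite reductive quotient].
WHAT (abstract form).  `G` a group acting on a FINITE set `X`, `x₀ ∈ X` with `G • x₀ = X` (transitive), `B ≤ G` fixing `x₀` (ANY subgroup — it acts on `X` through the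
finite image `B.map (MulAction.toPermHom G X)`, over which we average), `k` a field of characteristic zero, `W ≤ (X → k)` a subspace stable under the translations
`f ↦ f (g • ·)`.  THEN:
* §1 `sum_apply_smul_eq` — `Σ_x f (g • x) = Σ_x f x`.
* §2 **`apply_eq_apply_base_of_fixed_imp_const`** — if every `B`-fixed element of `W` is constant, EVERY element of `W` is constant
  (proof: the `B`-average `A` of `x ↦ f (g • x)` lies in `W`, is `B`-fixed, hence constant `= |B̄|·f(g • x₀)`; summing over `X` gives `|X|·f(g • x₀) = Σ_x f x` for all `g`).
* §3 `le_span_const_of_fixed_imp_const` (`W ≤ k ∙ 𝟙`), **`finrank_le_one_of_fixed_imp_const`** (`dim W ≤ 1`), `finrank_eq_one_of_fixed_imp_const` (`dim W = 1` when `𝟙 ∈ W`).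
Consumers (sub-bricks (3b)–(3e), K2E3-p17 REPORT-FIRST 23:50:39Z): `W = (πⁿ)^{K₀⁺} ≤ i_G(χ₁)^{K₀⁺} ≅ Fun(I∖K₀)` and `W = (π²)^{K₂⁺} ≤ Fun(I∖K₂)`.

HONEST LABEL: HC_CM is proved only modulo the 7 printed citations (2 remaining named inputs: hLiu418 = stmt-HodgeConjecture-24832, h413 =
stmt-HodgeConjecture-24833) until rung 0 closes; `--supports stmt-HodgeConjecture-24833` helper, COUNT-NEUTRAL (the socket #20′ it serves is not yet minted).

## References
* [Borel1976] A. Borel, *Admissible representations of a semi-simple group over a local field with vectors fixed under an Iwahori subgroup*, Invent. Math. 35 (1976), §3–§4.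
* [Casselman1995] W. Casselman, *Introduction to the theory of admissible representations of 𝔭-adic reductive groups* (1995), §3 (the `K⁺`-fixed vectors as a module for `K∕K⁺`).
* [SchneiderStuhler1997] P. Schneider, U. Stuhler, *Representation theory and sheaves on the Bruhat–Tits building*, Publ. Math. IHÉS 85 (1997), §III.4 (the K-type Euler–Poincaré function).
-/

set_option autoImplicit false
-- the mandated namespace has the single-problem summit's repeated segment (`HodgeConjecture.HodgeConjecture`)
set_option linter.dupNamespace false

open scoped BigOperators

namespace Summit.HodgeConjecture.HodgeConjecture.Cruxes.H413.K2E3PermutationModuleBorelFixedConstant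

variable {G X k : Type*} [Group G] [MulAction G X] [Fintype X] [Field k]

/-! ## §1  Translation invariance of the total sum -/

/-- **`Σ_x f (g • x) = Σ_x f x`** on a finite `G`-set (reindex by the permutation `x ↦ g • x`). [cite: Borel1976, §3] -/
theorem sum_apply_smul_eq (f : X → k) (g : G) : ∑ x, f (g • x) = ∑ x, f x :=
  Fintype.sum_equiv (MulAction.toPerm g) _ _ (fun _ => rfl)

/-- **`Σ_x f (g • σ x) = Σ_x f x`** for a permutation `σ` followed by a translation. [cite: Borel1976, §3] -/
theorem sum_apply_smul_perm_eq (f : X → k) (g : G) (σ : Equiv.Perm X) : ∑ x, f (g • σ x) = ∑ x, f x :=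
  Fintype.sum_equiv (σ.trans (MulAction.toPerm g)) _ _ (fun _ => rfl)

/-! ## §2  The averaging lemma -/

/-- **THE AVERAGING LEMMA.**  `G` acts on the finite set `X` transitively from `x₀` (`htrans`), the subgroup `B` fixes `x₀` (`hBx₀`), `k` has characteristic zero,
and `W ≤ (X → k)` is stable under every translation `f ↦ f (g • ·)` (`hW`).  If every `B`-fixed element of `W` is constant (`hB`), then EVERY element of `W` is
constant: `f x = f x₀`.  (For `X = I∖K`, `B = I`: «a `K`-stable subspace of the permutation module `Fun(I∖K)` whose `I`-fixed vectors are the constants is the line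
of constants» — the structural input behind `dim (πⁿ)^{K₀⁺} = 1`, `dim (π²)^{K₂⁺} = 1` at depth zero.) [cite: Borel1976, §3–§4] [cite: Casselman1995, §3] -/
theorem apply_eq_apply_base_of_fixed_imp_const [CharZero k]
    (B : Subgroup G) (x₀ : X) (hBx₀ : ∀ b ∈ B, b • x₀ = x₀) (htrans : ∀ x : X, ∃ g : G, g • x₀ = x)
    (W : Submodule k (X → k)) (hW : ∀ (g : G), ∀ f ∈ W, (fun x => f (g • x)) ∈ W)
    (hB : ∀ f ∈ W, (∀ b ∈ B, ∀ x : X, f (b • x) = f x) → ∀ x, f x = f x₀)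
    {f : X → k} (hf : f ∈ W) (x : X) : f x = f x₀ := by
  classical
  -- the finite image `S` of `B` in `Perm X`
  set Φ : G →* Equiv.Perm X := MulAction.toPermHom G X with hΦ
  let S : Subgroup (Equiv.Perm X) := B.map Φ
  haveI : Fintype S := Fintype.ofFinite _
  have hΦapp : ∀ (g : G) (y : X), (Φ g) y = g • y := fun g y => rfl
  have hSx₀ : ∀ σ : S, (σ : Equiv.Perm X) x₀ = x₀ := by
    intro σ
    obtain ⟨b, hb, hbσ⟩ := Subgroup.mem_map.1 σ.2
    rw [← hbσ, hΦapp]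
    exact hBx₀ b hb
  have hS : (Fintype.card S : k) ≠ 0 := Nat.cast_ne_zero.2 Fintype.card_ne_zero
  have hXne : (Fintype.card X : k) ≠ 0 := by
    haveI : Nonempty X := ⟨x₀⟩
    exact Nat.cast_ne_zero.2 Fintype.card_ne_zero
  -- KEY: `|X| · f (g • x₀) = Σ_y f y` for every `g`
  have key : ∀ g : G, (Fintype.card X : k) * f (g • x₀) = ∑ y, f y := by
    intro g
    -- the `B`-average of `x ↦ f (g • x)`
    let A : X → k := fun y => ∑ σ : S, f (g • (σ : Equiv.Perm X) y)
    have hA_mem : A ∈ W := by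
      have hterm : ∀ σ : S, (fun y => f (g • (σ : Equiv.Perm X) y)) ∈ W := by
        intro σ
        obtain ⟨b, hb, hbσ⟩ := Subgroup.mem_map.1 σ.2
        have heq : (fun y => f (g • (σ : Equiv.Perm X) y)) = fun y => f ((g * b) • y) := by
          funext y
          rw [← hbσ, hΦapp, mul_smul]
        rw [heq]
        exact hW (g * b) f hf
      have hAeq : A = ∑ σ : S, (fun y => f (g • (σ : Equiv.Perm X) y)) := by
        funext y
        simp only [A, Finset.sum_apply]
      rw [hAeq]
      exact W.sum_mem fun σ _ => hterm σ
    have hA_fix : ∀ b ∈ B, ∀ y : X, A (b • y) = A y := by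
      intro b hb y
      simp only [A]
      let τ : S := ⟨Φ b, Subgroup.mem_map_of_mem Φ hb⟩
      refine Fintype.sum_equiv (Equiv.mulRight τ) _ _ (fun σ => ?_)
      simp only [Equiv.coe_mulRight, Subgroup.coe_mul, Equiv.Perm.coe_mul, Function.comp_apply, τ, hΦapp]
    have hA_const : ∀ y, A y = A x₀ := hB A hA_mem hA_fix
    have hAx₀ : A x₀ = (Fintype.card S : k) * f (g • x₀) := by
      simp only [A, hSx₀, Finset.sum_const, Finset.card_univ, nsmul_eq_mul]
    -- Σ_y A y computed two ways
    have h1 : ∑ y, A y = (Fintype.card X : k) * ((Fintype.card S : k) * f (g • x₀)) := by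
      rw [Finset.sum_congr rfl (fun y _ => hA_const y), Finset.sum_const, Finset.card_univ, nsmul_eq_mul, hAx₀]
    have h2 : ∑ y, A y = (Fintype.card S : k) * ∑ y, f y := by
      simp only [A]
      rw [Finset.sum_comm]
      have hin : ∀ σ : S, ∑ y, f (g • (σ : Equiv.Perm X) y) = ∑ y, f y := fun σ => sum_apply_smul_perm_eq f g σ
      simp only [hin, Finset.sum_const, Finset.card_univ, nsmul_eq_mul]
    have h12 : (Fintype.card S : k) * ((Fintype.card X : k) * f (g • x₀)) = (Fintype.card S : k) * ∑ y, f y := by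
      rw [← h2, h1]; ring
    exact mul_left_cancel₀ hS h12
  -- conclude by transitivity
  obtain ⟨g, rfl⟩ := htrans x
  have e1 := key g
  have e2 := key 1
  rw [one_smul] at e2
  exact mul_left_cancel₀ hXne (e1.trans e2.symm)

/-! ## §3  Dimension forms -/

/-- Under the hypotheses of the averaging lemma, **`W` lies in the line of constants**: `W ≤ k ∙ 𝟙`. [cite: Borel1976, §3–§4] -/
theorem le_span_const_of_fixed_imp_const [CharZero k]
    (B : Subgroup G) (x₀ : X) (hBx₀ : ∀ b ∈ B, b • x₀ = x₀) (htrans : ∀ x : X, ∃ g : G, g • x₀ = x)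
    (W : Submodule k (X → k)) (hW : ∀ (g : G), ∀ f ∈ W, (fun x => f (g • x)) ∈ W)
    (hB : ∀ f ∈ W, (∀ b ∈ B, ∀ x : X, f (b • x) = f x) → ∀ x, f x = f x₀) :
    W ≤ k ∙ (fun _ : X => (1 : k)) := by
  intro f hf
  rw [Submodule.mem_span_singleton]
  refine ⟨f x₀, ?_⟩
  funext x
  simp only [Pi.smul_apply, smul_eq_mul, mul_one]
  exact (apply_eq_apply_base_of_fixed_imp_const B x₀ hBx₀ htrans W hW hB hf x).symm

/-- Under the hypotheses of the averaging lemma, **`dim W ≤ 1`**. [cite: Borel1976, §3–§4] [cite: Casselman1995, §3] -/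
theorem finrank_le_one_of_fixed_imp_const [CharZero k]
    (B : Subgroup G) (x₀ : X) (hBx₀ : ∀ b ∈ B, b • x₀ = x₀) (htrans : ∀ x : X, ∃ g : G, g • x₀ = x)
    (W : Submodule k (X → k)) (hW : ∀ (g : G), ∀ f ∈ W, (fun x => f (g • x)) ∈ W)
    (hB : ∀ f ∈ W, (∀ b ∈ B, ∀ x : X, f (b • x) = f x) → ∀ x, f x = f x₀) :
    Module.finrank k W ≤ 1 := by
  classical
  refine (Submodule.finrank_mono (le_span_const_of_fixed_imp_const B x₀ hBx₀ htrans W hW hB)).trans ?_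
  exact (finrank_span_le_card ({fun _ : X => (1 : k)} : Set (X → k))).trans (by simp)

/-- Under the hypotheses of the averaging lemma, if moreover `W` contains the constant function `𝟙` (a «spherical vector»), then **`dim W = 1`**: `W` IS the
spherical line. [cite: Borel1976, §3–§4] [cite: Casselman1995, §3] -/
theorem finrank_eq_one_of_fixed_imp_const [CharZero k]
    (B : Subgroup G) (x₀ : X) (hBx₀ : ∀ b ∈ B, b • x₀ = x₀) (htrans : ∀ x : X, ∃ g : G, g • x₀ = x)
    (W : Submodule k (X → k)) (hW : ∀ (g : G), ∀ f ∈ W, (fun x => f (g • x)) ∈ W)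
    (hB : ∀ f ∈ W, (∀ b ∈ B, ∀ x : X, f (b • x) = f x) → ∀ x, f x = f x₀)
    (h1 : (fun _ : X => (1 : k)) ∈ W) :
    Module.finrank k W = 1 := by
  haveI : Nonempty X := ⟨x₀⟩
  have hle := le_span_const_of_fixed_imp_const B x₀ hBx₀ htrans W hW hB
  have hge : k ∙ (fun _ : X => (1 : k)) ≤ W := (Submodule.span_singleton_le_iff_mem _ _).2 h1
  have heq : W = k ∙ (fun _ : X => (1 : k)) := le_antisymm hle hge
  rw [heq]
  exact finrank_span_singleton (by
    intro h
    have := congr_fun h (Classical.arbitrary X)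
    simp at this)

end Summit.HodgeConjecture.HodgeConjecture.Cruxes.H413.K2E3PermutationModuleBorelFixedConstant
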